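import Literature.Geometry.Kaehler.HolomorphicChainAddConditional
import Literature.Geometry.Kaehler.LelongTheorem
import HarnessLib

/-!
# Additivity of the current of a holomorphic chain, IV: discharge of `Chirka1989_toCurrent_add`

`Literature.Geometry.Kaehler.Chirka1989_toCurrent_add_holds`: the named fact
`Literature.Geometry.Kaehler.Chirka1989_toCurrent_add` of
`Literature/Geometry/Kaehler/HolomorphicChainFacts.lean` — **`[T + T'] = [T] + [T']` for holomorphic
`p`-chains `T, T'` on an open subset of a finite-dimensional complex inner product space**
([Chirka1989, §16.1, p. 206]: "each holomorphic `p`-chain `T = Σ kᵢ Aᵢ` … determines a current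
`Σ kᵢ [Aᵢ]` … formal sums of the form `kA − kA` correspond to the current equal to zero") — is a
theorem of the tree: `Chirka1989_toCurrent_add_of_lelong` (`HolomorphicChainAddConditional.lean`:
density additivity, locality of the orientation frame, `𝓗^{2p}`-nullity of the intersections of
distinct components via the dimension theory of analytic sets, and Harvey's structure fact
`Harvey1977_isRectifiableData_toCurrent_of_lelong`) applied to Lelong's theorem
`Lelong1957_hausdorffMeasure_inter_lt_top_holds` (`LelongTheorem.lean`).

No named facts, no definitions.

## References

* E. M. Chirka, *Complex Analytic Sets*, Kluwer 1989, §14.1 Thm. (p. 174), §16.1 (p. 206)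
  [Chirka1989].
-/

namespace Literature.Geometry.Kaehler

universe u

/-- **`[T + T'] = [T] + [T']`** — discharge of the named fact `Chirka1989_toCurrent_add`: the current
of a sum of holomorphic `p`-chains is the sum of their currents. [cite: Chirka1989, §16.1, p. 206] -/
theorem Chirka1989_toCurrent_add_holds : Chirka1989_toCurrent_add.{u} :=
  Chirka1989_toCurrent_add_of_lelong Lelong1957_hausdorffMeasure_inter_lt_top_holds

end Literature.Geometry.Kaehler
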